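import Literature.Analysis.FluidPDE.NSCriticalClosureBesovProofs
import Literature.Analysis.FunctionSpaces.BesovFatou
import HarnessLib

/-!
# The final-time slice of a Leray–Hopf solution as a tempered distribution; Besov bounds pass to it

Analysis/FluidPDE proof file (theorems only: no definition, no named fact). For a Leray–Hopf
solution `u` on `ℝ³ × [0, T)` (`IsLerayHopfOn T ν f u₀ u`: in particular `u(t) ∈ L²` for every
`t ∈ [0, T]` and `t ↦ ∫ ⟪u(t), w⟫` is continuous on `(0, T]` for every `w ∈ L²`) whose slices
`u(t)`, `0 < t < T`, have tempered distributions `U(t)`: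

* `IsLerayHopfOn.tendsto_integral_smul_complexify_nhdsLT` — the Schwartz pairings
  `∫ θ • u(t) → ∫ θ • u(T)` as `t → T⁻` (the weak `L²` continuity, read componentwise on the real
  and imaginary parts of `θ`);
* `IsLerayHopfOn.exists_isDistributionOf_tendsto_nhdsLT` — **the final-time slice `u(T) ∈ L²`
  has a tempered distribution `U_T`, and `U(t) → U_T` in `𝓢'` as `t → T⁻`**;
* `IsLerayHopfOn.exists_isDistributionOf_final_memHomBesov` — **bounds on the critical Besov
  norms pass to the final time**: if `‖U(t)‖_{Ḃ^s_{p,q}} ≤ M` on `[0, T)` (`-2 < s < 0`, `q ≠ 0`,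
  `M < ∞`), then `U_T ∈ Ḃ^s_{p,q}` (realised) with `‖U_T‖_{Ḃ^s_{p,q}} ≤ M` — the Fatou property
  `FunctionSpaces.memHomBesov_of_tendsto` (Bahouri–Chemin–Danchin 2011, Thm. 2.25) along
  `t → T⁻`, the slices being realised as `L²` functions (`tendsto_lowFreqCutoff_of_memLp_two_holds`).

This is the input "`u(T) ∈ Ḃ^{-1+3/p}_{p,q}` with `‖u(T)‖ ≤ M`" of the final step of the blow-up
proofs of the critical Besov regularity criterion (W. Wang, Z. Zhang, arXiv:1510.02589, §4
Step 2: the rescalings of `u(T)` about the singular point tend to zero because `q < ∞`,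
`CriticalBesovRescalingVanishing.lean`), in the setting of the named fact
`Literature.Analysis.FluidPDE.hasSmoothExtensionPast_of_eHomBesovNorm_bounded`.

## References

* J. Leray, Acta Math. 63 (1934), §31 (weak continuity in `L²` of turbulent solutions);
  G. P. Galdi, *An introduction to the Navier–Stokes initial-boundary value problem* (2000),
  Lemma 2.2. [Leray1934]
* H. Bahouri, J.-Y. Chemin, R. Danchin, *Fourier Analysis and Nonlinear PDE* (2011), Thm. 2.25.
  [BahouriCheminDanchin2011]
* W. Wang, Z. Zhang, Sci. China Math. 60 (2017) 637–650 = arXiv:1510.02589, §4 Step 2.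
  [WangZhang2016]
-/

noncomputable section

open MeasureTheory Filter Set Function
open _root_.Topology
open scoped SchwartzMap ENNReal NNReal RealInnerProductSpace

namespace Literature.Analysis.FluidPDE

open FunctionSpaces.EuclideanSpace (complexify)

/-! ## Schwartz pairings of a real field, componentwise -/

section Pairings

variable {ι : Type*} [Fintype ι] [DecidableEq ι] {E : Type*} [NormedAddCommGroup E]
  [InnerProductSpace ℝ E] [FiniteDimensional ℝ E] [MeasurableSpace E] [BorelSpace E]

/-- The components of the Schwartz pairing `∫ θ • u` of a real field through real `L²` pairings:
`(∫ θ • u)_i = ∫ ⟪u, (Re θ) e_i⟫ + i ∫ ⟪u, (Im θ) e_i⟫`. [folklore] -/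
theorem integral_smul_complexify_apply_eq {v : E → EuclideanSpace ℝ ι} (θ : 𝓢(E, ℂ))
    (hint : Integrable (fun x => θ x • complexify (v x))) (i : ι) :
    (∫ x, θ x • complexify (v x)) i =
      ((∫ x, ⟪v x, (θ x).re • EuclideanSpace.single i (1 : ℝ)⟫ : ℝ) : ℂ) +
        ((∫ x, ⟪v x, (θ x).im • EuclideanSpace.single i (1 : ℝ)⟫ : ℝ) : ℂ) * Complex.I := by
  have h1 : (∫ x, θ x • complexify (v x)) i = ∫ x, (θ x • complexify (v x)) i := by
    rw [show (∫ x, θ x • complexify (v x)) i =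
        EuclideanSpace.proj (𝕜 := ℂ) i (∫ x, θ x • complexify (v x)) from rfl,
      ← (EuclideanSpace.proj (𝕜 := ℂ) i).integral_comp_comm hint]
    rfl
  have h2 : ∀ x, (θ x • complexify (v x)) i = θ x * ((v x i : ℝ) : ℂ) := fun x => by
    simp [FunctionSpaces.EuclideanSpace.complexify_apply]
  have hint' : Integrable (fun x => θ x * ((v x i : ℝ) : ℂ)) := by
    have h := (EuclideanSpace.proj (𝕜 := ℂ) i).integrable_comp hint
    refine h.congr (ae_of_all _ fun x => ?_)
    exact h2 x
  rw [h1]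
  simp_rw [h2]
  rw [← integral_re_add_im hint']
  have hre : ∀ x, RCLike.re (θ x * ((v x i : ℝ) : ℂ)) = ⟪v x, (θ x).re • EuclideanSpace.single i (1 : ℝ)⟫ := by
    intro x
    rw [real_inner_smul_right, EuclideanSpace.inner_single_right]
    simp
  have him : ∀ x, RCLike.im (θ x * ((v x i : ℝ) : ℂ)) = ⟪v x, (θ x).im • EuclideanSpace.single i (1 : ℝ)⟫ := by
    intro x
    rw [real_inner_smul_right, EuclideanSpace.inner_single_right]
    simp
  simp_rw [hre, him]
  simp

/-- The real test fields `(Re θ) e_i`, `(Im θ) e_i` are square integrable. [folklore] -/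
theorem memLp_two_re_smul_single (θ : 𝓢(E, ℂ)) (i : ι) :
    MemLp (fun x => (θ x).re • EuclideanSpace.single i (1 : ℝ)) 2 volume ∧
      MemLp (fun x => (θ x).im • EuclideanSpace.single i (1 : ℝ)) 2 volume := by
  have hθ : MemLp (θ : E → ℂ) 2 (volume : Measure E) := θ.memLp 2 volume
  constructor
  · refine MemLp.of_le hθ ((Complex.continuous_re.comp θ.continuous).smul
      continuous_const).aestronglyMeasurable (ae_of_all _ fun x => ?_)
    rw [norm_smul, PiLp.norm_single, norm_one, mul_one]
    exact RCLike.norm_re_le_norm (θ x)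
  · refine MemLp.of_le hθ ((Complex.continuous_im.comp θ.continuous).smul
      continuous_const).aestronglyMeasurable (ae_of_all _ fun x => ?_)
    rw [norm_smul, PiLp.norm_single, norm_one, mul_one]
    exact RCLike.norm_im_le_norm (θ x)

end Pairings

/-! ## The final-time slice of a Leray–Hopf solution on `ℝ³` -/

section FinalTime

variable {T ν : ℝ} {f u : ℝ → EuclideanSpace ℝ (Fin 3) → EuclideanSpace ℝ (Fin 3)}
  {u₀ : EuclideanSpace ℝ (Fin 3) → EuclideanSpace ℝ (Fin 3)}

/-- **Weak `L²` continuity at the final time, read on Schwartz pairings**: for a Leray–Hopf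
solution on `[0, T)`, `T > 0`, whose slices on `(0, T]` have integrable Schwartz pairings,
`∫ θ • u(t) → ∫ θ • u(T)` as `t → T⁻` for every Schwartz `θ` (Leray 1934, §31; Galdi 2000,
Lemma 2.2: `t ↦ ∫ ⟪u(t), w⟫` is continuous on `(0, T]` for `w ∈ L²`). [cite: Leray1934, §31] -/
theorem IsLerayHopfOn.tendsto_integral_smul_complexify_nhdsLT (hLH : IsLerayHopfOn T ν f u₀ u)
    (hT : 0 < T) (θ : 𝓢(EuclideanSpace ℝ (Fin 3), ℂ))
    (hint : ∀ t ∈ Ioc 0 T, Integrable (fun x => θ x • complexify (u t x))) :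
    Tendsto (fun t => ∫ x, θ x • complexify (u t x)) (𝓝[<] T)
      (𝓝 (∫ x, θ x • complexify (u T x))) := by
  -- the real pairings `A_k(t) = ∫ ⟪u t, w_k⟫` are continuous on `(0, T]`
  set w₁ : Fin 3 → EuclideanSpace ℝ (Fin 3) → EuclideanSpace ℝ (Fin 3) := fun i x =>
    (θ x).re • EuclideanSpace.single i (1 : ℝ) with hw₁
  set w₂ : Fin 3 → EuclideanSpace ℝ (Fin 3) → EuclideanSpace ℝ (Fin 3) := fun i x =>
    (θ x).im • EuclideanSpace.single i (1 : ℝ) with hw₂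
  have hle : 𝓝[<] T ≤ 𝓝[Ioc 0 T] T := by
    rw [← nhdsWithin_Ioo_eq_nhdsLT hT]
    exact nhdsWithin_mono _ Ioo_subset_Ioc_self
  have hTmem : T ∈ Ioc 0 T := ⟨hT, le_rfl⟩
  have hA : ∀ i, Tendsto (fun t => ∫ x, ⟪u t x, w₁ i x⟫) (𝓝[<] T) (𝓝 (∫ x, ⟪u T x, w₁ i x⟫)) ∧
      Tendsto (fun t => ∫ x, ⟪u t x, w₂ i x⟫) (𝓝[<] T) (𝓝 (∫ x, ⟪u T x, w₂ i x⟫)) := by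
    intro i
    obtain ⟨hm₁, hm₂⟩ := memLp_two_re_smul_single θ i
    exact ⟨((hLH.weak_continuous (w₁ i) hm₁).1 T hTmem).tendsto.mono_left hle,
      ((hLH.weak_continuous (w₂ i) hm₂).1 T hTmem).tendsto.mono_left hle⟩
  -- componentwise convergence of the complex pairings
  have hcomp : ∀ i, Tendsto (fun t => (∫ x, θ x • complexify (u t x)) i) (𝓝[<] T)
      (𝓝 ((∫ x, θ x • complexify (u T x)) i)) := by
    intro i
    have hlim : Tendsto (fun t => ((∫ x, ⟪u t x, w₁ i x⟫ : ℝ) : ℂ) +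
        ((∫ x, ⟪u t x, w₂ i x⟫ : ℝ) : ℂ) * Complex.I) (𝓝[<] T)
        (𝓝 (((∫ x, ⟪u T x, w₁ i x⟫ : ℝ) : ℂ) + ((∫ x, ⟪u T x, w₂ i x⟫ : ℝ) : ℂ) * Complex.I)) :=
      ((Complex.continuous_ofReal.tendsto _).comp (hA i).1).add
        (((Complex.continuous_ofReal.tendsto _).comp (hA i).2).mul_const _)
    rw [integral_smul_complexify_apply_eq θ (hint T hTmem) i]
    refine hlim.congr' ?_
    filter_upwards [Ioo_mem_nhdsLT hT] with t ht
    rw [integral_smul_complexify_apply_eq θ (hint t (Ioo_subset_Ioc_self ht)) i]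
  -- reassemble the vector
  have hvec : Tendsto (fun t => (EuclideanSpace.equiv (Fin 3) ℂ).symm
      (fun i => (∫ x, θ x • complexify (u t x)) i)) (𝓝[<] T)
      (𝓝 ((EuclideanSpace.equiv (Fin 3) ℂ).symm (fun i => (∫ x, θ x • complexify (u T x)) i))) :=
    ((EuclideanSpace.equiv (Fin 3) ℂ).symm.continuous.tendsto _).comp (tendsto_pi_nhds.2 hcomp)
  exact hvec

/-- **The final-time slice of a Leray–Hopf solution has a tempered distribution, the `𝓢'`-limit
of the slice distributions**: for `IsLerayHopfOn T ν f u₀ u`, `T > 0`, and tempered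
distributions `U(t)` of `u(t)`, `0 < t < T`, there is `U_T` with `IsDistributionOf (u T) U_T`
(`u(T) ∈ L²`) and `U(t) → U_T` in `𝓢'` as `t → T⁻`. [cite: Leray1934, §31] -/
theorem IsLerayHopfOn.exists_isDistributionOf_tendsto_nhdsLT (hLH : IsLerayHopfOn T ν f u₀ u)
    (hT : 0 < T)
    {U : ℝ → 𝓢'(EuclideanSpace ℝ (Fin 3), EuclideanSpace ℂ (Fin 3))}
    (hU : ∀ t ∈ Ioo 0 T, IsDistributionOf (u t) (U t)) :
    ∃ UT : 𝓢'(EuclideanSpace ℝ (Fin 3), EuclideanSpace ℂ (Fin 3)),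
      IsDistributionOf (u T) UT ∧ Tendsto U (𝓝[<] T) (𝓝 UT) := by
  haveI : Fact ((1 : ℝ≥0∞) ≤ 2) := ⟨by norm_num⟩
  obtain ⟨UT, hUT⟩ := exists_isDistributionOf_of_memLp (p := 2) (hLH.memLp T ⟨hT.le, le_rfl⟩)
  refine ⟨UT, hUT, ?_⟩
  rw [PointwiseConvergenceCLM.tendsto_iff_forall_tendsto]
  intro θ
  have hint : ∀ t ∈ Ioc 0 T, Integrable (fun x => θ x • complexify (u t x)) := by
    intro t ht
    rcases eq_or_lt_of_le ht.2 with h | h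
    · rw [h]
      exact (hUT θ).1
    · exact (hU t ⟨ht.1, h⟩ θ).1
  have hP := hLH.tendsto_integral_smul_complexify_nhdsLT hT θ hint
  rw [(hUT θ).2]
  refine hP.congr' ?_
  filter_upwards [Ioo_mem_nhdsLT hT] with t ht
  exact ((hU t ht θ).2).symm

/-- **Critical Besov bounds pass to the final time** (Wang–Zhang 2017, §4 Step 2, input; BCD
Thm. 2.25): in the setting of `hasSmoothExtensionPast_of_eHomBesovNorm_bounded` — a Leray–Hopf
solution on `[0, T)` with slice distributions `U(t)`, `t ∈ [0, T)`, and
`‖U(t)‖_{Ḃ^s_{p,q}} ≤ M < ∞` there (`-2 < s < 0`, `1 ≤ p ≤ ∞`, `q ≠ 0`) — the final slice `u(T)`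
has a tempered distribution `U_T`, the `𝓢'`-limit of `U(t)` as `t → T⁻`, which lies in
`Ḃ^s_{p,q}` (realised) with `‖U_T‖_{Ḃ^s_{p,q}} ≤ M`. [cite: WangZhang2016, §4 Step 2] -/
theorem IsLerayHopfOn.exists_isDistributionOf_final_memHomBesov (hLH : IsLerayHopfOn T ν f u₀ u)
    (hT : 0 < T)
    {U : ℝ → 𝓢'(EuclideanSpace ℝ (Fin 3), EuclideanSpace ℂ (Fin 3))}
    (hU : ∀ t ∈ Ico 0 T, IsDistributionOf (u t) (U t)) {s : ℝ} (hs : -2 < s) (hs0 : s < 0)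
    (p : ℝ≥0∞) [Fact (1 ≤ p)] {q : ℝ≥0∞} (hq : q ≠ 0) {M : ℝ≥0∞} (hMtop : M ≠ ⊤)
    (hM : ∀ t ∈ Ico 0 T, FunctionSpaces.eHomBesovNorm s p q (U t) ≤ M) :
    ∃ UT : 𝓢'(EuclideanSpace ℝ (Fin 3), EuclideanSpace ℂ (Fin 3)),
      IsDistributionOf (u T) UT ∧ Tendsto U (𝓝[<] T) (𝓝 UT) ∧
        FunctionSpaces.MemHomBesov s p q UT ∧ FunctionSpaces.eHomBesovNorm s p q UT ≤ M := by
  obtain ⟨UT, hUT, hlim⟩ := hLH.exists_isDistributionOf_tendsto_nhdsLT hT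
    fun t ht => hU t (Ioo_subset_Ico_self ht)
  have hmem : ∀ᶠ t in 𝓝[<] T, FunctionSpaces.MemHomBesov s p q (U t) := by
    filter_upwards [Ioo_mem_nhdsLT hT] with t ht
    exact ⟨(hM t (Ioo_subset_Ico_self ht)).trans_lt hMtop.lt_top,
      tendsto_lowFreqCutoff_of_memLp_two_holds (hLH.memLp t ⟨ht.1.le, ht.2.le⟩)
        (hU t (Ioo_subset_Ico_self ht))⟩
  have hM' : ∀ᶠ t in 𝓝[<] T, FunctionSpaces.eHomBesovNorm s p q (U t) ≤ M := by
    filter_upwards [Ioo_mem_nhdsLT hT] with t ht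
    exact hM t (Ioo_subset_Ico_self ht)
  obtain ⟨hmemT, hMT⟩ := FunctionSpaces.memHomBesov_of_tendsto hlim hs hs0 p hq hMtop hmem hM'
  exact ⟨UT, hUT, hlim, hmemT, hMT⟩

end FinalTime

end Literature.Analysis.FluidPDE

end
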